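import Summits.Ventures.Crystal3D.Bulk.RotSysCounts
import HarnessLib

/-!
# Deleting one edge from a sub-rotation-system: the pointwise splice of the face permutation and
# the vertex count (generic brick (G1c), first part, of `phase2/LEAN-FACES-DESIGN.md` §5.4)

HONEST FRAMING. Part of the venture `Summits/Ventures/Crystal3D` (cell `pub-crystal3d`, phase 2;
seat typer-bulk-2), PURELY COMBINATORIAL and generic (folklore). For a loopless rotation system
`(σ, α)` (`Bulk/RotSysCounts.lean`), an `α`-closed dart set `S` and an edge `e = {d, α d} ⊆ S`,
the deletion lemma of the design note compares the counts of `S` and of `S \ e`. This file proves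
its first two ingredients:

* (P) **the pointwise splice** `IsRotSys.phi_sdiff_apply`: for `x ∈ S \ e`,
  `φ_{S∖e} x = φ_S (α d)` if `φ_S x = d`, `= φ_S d` if `φ_S x = α d`, and `= φ_S x` otherwise
  (one skip of the induced rotation, `Bulk/RotSysInduce.lean`); with the supporting facts
  `isClosed_sdiff_pair`, `IsRotSys.induce_ne_alpha` (the `S`-successor of `d` is never `α d`),
  `IsRotSys.induce_ne_self_of_mem_cycle`;
* (V) **classes under erasing one point** `numClasses_erase` (for an equivalence relation on `S`:
  erasing `d` loses a class iff `d` was alone in its class) and the vertex count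
  `numV_erase` (`numV (S.erase d) + [d alone at its vertex in S] = numV S`);
* (K) `conn_mono`, `conn_sdiff_or`, `IsRotSys.exists_near_of_conn` (every surviving dart of the
  component of `d` stays connected in `S ∖ e` to a surviving dart at an end-vertex of `e`),
  `IsRotSys.numClasses_conn_sdiff` and
  **`IsRotSys.numK_le_numK_sdiff_add`**: `numK S ≤ numK (S ∖ e) + [component of d = e]`.

The face count (F), the upper half of (K) (`numK (S ∖ e) ≤ numK S + 1`, with equality analysis)
and the assembled inequality
`chi2 (S∖e) − 4·numK (S∖e) ≥ chi2 S − 4·numK S` are NOT here (successor, design note §5.4).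
-/

namespace Summit.Ventures.Crystal3D

namespace RotSys

open Equiv Equiv.Perm Finset

variable {D : Type*} [DecidableEq D]

/-! ## (V) Classes of an equivalence relation under erasing one point -/

section Classes

open scoped Classical

/-- The class of `x` in `S.erase d` is its class in `S` with `d` erased. -/
theorem filter_erase_eq {R : D → D → Prop} (S : Finset D) (d x : D) :
    ((S.erase d).filter fun z => R x z) = (S.filter fun z => R x z).erase d := by
  ext z
  simp only [Finset.mem_filter, Finset.mem_erase]
  tauto

/-- **Erasing one point from an equivalence relation's domain**: the number of classes drops by
one if `d` was ALONE in its class, and is unchanged otherwise. (`R` reflexive, symmetric,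
transitive on `S`; `d ∈ S`.) -/
theorem numClasses_erase {R : D → D → Prop} {S : Finset D}
    (hrefl : ∀ x ∈ S, R x x)
    (hsymm : ∀ x ∈ S, ∀ y ∈ S, R x y → R y x)
    (htrans : ∀ x ∈ S, ∀ y ∈ S, ∀ z ∈ S, R x y → R y z → R x z)
    {d : D} (hd : d ∈ S) :
    numClasses R (S.erase d) + (if ∃ y ∈ S, y ≠ d ∧ R d y then 0 else 1) = numClasses R S := by
  unfold numClasses
  -- notation: the class map on `S`
  set cl : D → Finset D := fun x => S.filter fun z => R x z with hcl
  have hcl_eq : ∀ x ∈ S, ∀ y ∈ S, R x y → cl x = cl y :=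
    fun x hx y hy hxy => filter_eq_filter_of_rel hsymm htrans hx hy hxy
  have hmem_cl : ∀ x ∈ S, x ∈ cl x := fun x hx => Finset.mem_filter.2 ⟨hx, hrefl x hx⟩
  -- classes of `S.erase d` are the classes of the other points with `d` erased
  have himg : ((S.erase d).image fun x => (S.erase d).filter fun z => R x z) =
      ((S.erase d).image cl).image (fun C => C.erase d) := by
    rw [Finset.image_image]
    refine Finset.image_congr fun x _ => ?_
    exact filter_erase_eq S d x
  -- `C ↦ C.erase d` is injective on the classes of points of `S.erase d`
  have hinj : Set.InjOn (fun C : Finset D => C.erase d) ((S.erase d).image cl : Set (Finset D)) := by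
    intro C hC C' hC' hCC'
    rw [Finset.mem_coe, Finset.mem_image] at hC hC'
    obtain ⟨x, hx, rfl⟩ := hC
    obtain ⟨x', hx', rfl⟩ := hC'
    have hxS := (Finset.mem_erase.1 hx).2
    have hx'S := (Finset.mem_erase.1 hx').2
    -- `x ∈ cl x`, `x ≠ d`, so `x ∈ (cl x').erase d`, so `R x' x`
    have h1 : x ∈ (cl x).erase d := Finset.mem_erase.2 ⟨(Finset.mem_erase.1 hx).1, hmem_cl x hxS⟩
    have h1' : x ∈ (cl x').erase d := by
      have : (cl x).erase d = (cl x').erase d := hCC'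
      rw [← this]; exact h1
    have hR : R x' x := (Finset.mem_filter.1 (Finset.mem_erase.1 h1').2).2
    exact (hcl_eq x' hx'S x hxS hR).symm
  rw [himg, Finset.card_image_of_injOn hinj]
  -- now compare `(S.erase d).image cl` with `S.image cl`
  by_cases hex : ∃ y ∈ S, y ≠ d ∧ R d y
  · rw [if_pos hex, add_zero]
    congr 1
    -- same image: the class of `d` is also the class of `y`
    obtain ⟨y, hy, hyd, hdy⟩ := hex
    apply Finset.Subset.antisymm
    · exact Finset.image_subset_image (Finset.erase_subset d S)
    · intro C hC
      rw [Finset.mem_image] at hC ⊢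
      obtain ⟨x, hx, rfl⟩ := hC
      by_cases hxd : x = d
      · subst hxd
        exact ⟨y, Finset.mem_erase.2 ⟨hyd, hy⟩, (hcl_eq x hd y hy hdy).symm⟩
      · exact ⟨x, Finset.mem_erase.2 ⟨hxd, hx⟩, rfl⟩
  · rw [if_neg hex]
    -- the class of `d` is `{d}` and is NOT the class of any other point
    have hnot : cl d ∉ (S.erase d).image cl := by
      intro h
      rw [Finset.mem_image] at h
      obtain ⟨x, hx, hxe⟩ := h
      have hxS := (Finset.mem_erase.1 hx).2
      have hxd := (Finset.mem_erase.1 hx).1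
      have : x ∈ cl d := by rw [← hxe]; exact hmem_cl x hxS
      exact hex ⟨x, hxS, hxd, (Finset.mem_filter.1 this).2⟩
    have hS : S.image cl = insert (cl d) ((S.erase d).image cl) := by
      rw [← Finset.image_insert, Finset.insert_erase hd]
    rw [hS, Finset.card_insert_of_notMem hnot]

end Classes

open scoped Classical in
/-- **The vertex count under erasing one dart**: `numV (S.erase d) + [d alone at its vertex] =
numV S`, where "alone" means no other dart of `S` lies on the `σ`-cycle of `d`. -/
theorem numV_erase (σ : Perm D) {S : Finset D} {d : D} (hd : d ∈ S) :
    numV σ (S.erase d) + (if ∃ y ∈ S, y ≠ d ∧ σ.SameCycle d y then 0 else 1) = numV σ S :=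
  numClasses_erase (fun x _ => Equiv.Perm.SameCycle.refl σ x) (fun _ _ _ _ h => h.symm)
    (fun _ _ _ _ _ _ h1 h2 => h1.trans h2) hd

/-! ## (P) The pointwise splice of the face permutation -/

/-- Removing an edge `{d, α d}` from an `α`-closed set leaves an `α`-closed set. -/
theorem isClosed_sdiff_pair {σ α : Perm D} (h : IsRotSys σ α) {S : Finset D} (hS : IsClosed α S)
    (d : D) : IsClosed α (S \ {d, α d}) := by
  intro x hx
  rw [Finset.mem_sdiff] at hx ⊢
  refine ⟨hS x hx.1, ?_⟩
  intro hmem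
  rw [Finset.mem_insert, Finset.mem_singleton] at hmem
  apply hx.2
  rw [Finset.mem_insert, Finset.mem_singleton]
  rcases hmem with h1 | h1
  · right; rw [← h1, h.α_inv]
  · left; exact α.injective h1

/-! ## (K, lower half) Components can only be lost when the deleted edge was a whole component -/

omit [DecidableEq D] in
/-- Connectivity is monotone in the dart set. -/
theorem conn_mono {σ α : Perm D} {S S' : Finset D} (hsub : S' ⊆ S) {x y : D}
    (hc : conn σ α S' x y) : conn σ α S x y :=
  Relation.EqvGen.mono (fun _ _ hab => ⟨hsub hab.1, hsub hab.2.1, hab.2.2⟩) x y hc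

/-- `S ∖ {d, α d}` as a double erasure. -/
theorem sdiff_pair_eq_erase_erase (S : Finset D) (d d' : D) :
    S \ {d, d'} = (S.erase d).erase d' := by
  ext z
  simp only [Finset.mem_sdiff, Finset.mem_insert, Finset.mem_singleton, Finset.mem_erase, not_or]
  tauto

open scoped Classical in
/-- **Counting the `S`-components that survive in `S ∖ e`**: the number of `conn_S`-classes
meeting `S ∖ {d, α d}` is `numK S` minus one exactly when the component of `d` is the bare edge
`{d, α d}`. -/
theorem IsRotSys.numClasses_conn_sdiff {σ α : Perm D} (h : IsRotSys σ α) {S : Finset D}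
    (hS : IsClosed α S) {d : D} (hd : d ∈ S) :
    numClasses (conn σ α S) (S \ {d, α d}) +
        (if ∃ y ∈ S, y ≠ d ∧ y ≠ α d ∧ conn σ α S d y then 0 else 1) = numK σ α S := by
  have hαd : α d ∈ S := hS d hd
  have hne : α d ≠ d := h.α_ne d
  -- erase `d`: its class also contains `α d`, nothing is lost
  have step1 := numClasses_erase (R := conn σ α S) (S := S) (fun x _ => conn_refl σ α S x)
    (fun _ _ _ _ hc => conn_symm hc) (fun _ _ _ _ _ _ h1 h2 => conn_trans h1 h2) hd
  rw [if_pos ⟨α d, hαd, hne, conn_alpha hS hd⟩, add_zero] at step1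
  -- erase `α d` from `S.erase d`
  have hαd' : α d ∈ S.erase d := Finset.mem_erase.2 ⟨hne, hαd⟩
  have step2 := numClasses_erase (R := conn σ α S) (S := S.erase d)
    (fun x _ => conn_refl σ α S x) (fun _ _ _ _ hc => conn_symm hc)
    (fun _ _ _ _ _ _ h1 h2 => conn_trans h1 h2) hαd'
  rw [step1, ← sdiff_pair_eq_erase_erase] at step2
  -- the two indicator conditions agree (`d ~ α d`)
  have hiff : (∃ y ∈ S.erase d, y ≠ α d ∧ conn σ α S (α d) y) ↔
      ∃ y ∈ S, y ≠ d ∧ y ≠ α d ∧ conn σ α S d y := by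
    constructor
    · rintro ⟨y, hy, hyα, hc⟩
      exact ⟨y, (Finset.mem_erase.1 hy).2, (Finset.mem_erase.1 hy).1, hyα,
        conn_trans (conn_alpha hS hd) hc⟩
    · rintro ⟨y, hy, hyd, hyα, hc⟩
      exact ⟨y, Finset.mem_erase.2 ⟨hyd, hy⟩, hyα,
        conn_trans (conn_symm (conn_alpha hS hd)) hc⟩
  by_cases hex : ∃ y ∈ S, y ≠ d ∧ y ≠ α d ∧ conn σ α S d y
  · rw [if_pos hex]
    rw [if_pos (hiff.2 hex)] at step2
    exact step2
  · rw [if_neg hex]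
    rw [if_neg (fun h' => hex (hiff.1 h'))] at step2
    exact step2

open scoped Classical in
/-- **(K, lower half)**: deleting an edge loses at most one component, and only when that edge was
a whole component: `numK S ≤ numK (S ∖ {d, α d}) + [component of d = {d, α d}]`. -/
theorem IsRotSys.numK_le_numK_sdiff_add {σ α : Perm D} (h : IsRotSys σ α) {S : Finset D}
    (hS : IsClosed α S) {d : D} (hd : d ∈ S) :
    numK σ α S ≤ numK σ α (S \ {d, α d}) +
      (if ∃ y ∈ S, y ≠ d ∧ y ≠ α d ∧ conn σ α S d y then 0 else 1) := by
  rw [← h.numClasses_conn_sdiff hS hd]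
  refine Nat.add_le_add_right ?_ _
  -- on `S ∖ e`, `conn_{S∖e}` refines `conn_S`
  exact numClasses_le_of_imp (fun x _ => conn_refl σ α _ x) (fun _ _ _ _ hc => conn_symm hc)
    (fun _ _ _ _ _ _ h1 h2 => conn_trans h1 h2)
    (fun _ _ _ _ hc => conn_mono Finset.sdiff_subset hc)

/-! ## (K, upper half) The component of the deleted edge splits into at most two -/

/-- Along an `S`-connection either the connection survives in `S ∖ {d, α d}`, or both ends are
`S`-connected to `d`. -/
theorem conn_sdiff_or {σ α : Perm D} {S : Finset D}
    (hS : IsClosed α S) {d : D} (hd : d ∈ S) {x y : D} (hc : conn σ α S x y) :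
    conn σ α (S \ {d, α d}) x y ∨ (conn σ α S x d ∧ conn σ α S y d) := by
  -- an element of `S` outside `S ∖ e` is `d` or `α d`, hence connected to `d`
  have aux : ∀ b, b ∈ S → b ∉ S \ {d, α d} → conn σ α S b d := by
    intro b hb hbe
    rw [Finset.mem_sdiff, not_and, not_not, Finset.mem_insert, Finset.mem_singleton] at hbe
    rcases hbe hb with rfl | rfl
    · exact conn_refl σ α S b
    · exact conn_symm (conn_alpha hS hd)
  induction hc with
  | rel a b hab =>
    obtain ⟨ha, hb, hrel⟩ := hab
    by_cases hae : a ∈ S \ {d, α d}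
    · by_cases hbe : b ∈ S \ {d, α d}
      · exact Or.inl (Relation.EqvGen.rel a b ⟨hae, hbe, hrel⟩)
      · right
        have hbd := aux b hb hbe
        exact ⟨conn_trans (Relation.EqvGen.rel a b ⟨ha, hb, hrel⟩) hbd, hbd⟩
    · right
      have had := aux a ha hae
      exact ⟨had, conn_trans (conn_symm (Relation.EqvGen.rel a b ⟨ha, hb, hrel⟩)) had⟩
  | refl a => exact Or.inl (conn_refl σ α _ a)
  | symm a b _ ih =>
    rcases ih with h1 | ⟨h1, h2⟩
    · exact Or.inl (conn_symm h1)
    · exact Or.inr ⟨h2, h1⟩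
  | trans a b c hab _ ih1 ih2 =>
    rcases ih1 with h1 | ⟨h1, h2⟩
    · rcases ih2 with h3 | ⟨h3, h4⟩
      · exact Or.inl (conn_trans h1 h3)
      · exact Or.inr ⟨conn_trans (conn_mono Finset.sdiff_subset h1) h3, h4⟩
    · rcases ih2 with h3 | ⟨h3, h4⟩
      · exact Or.inr ⟨h1, conn_trans (conn_symm (conn_mono Finset.sdiff_subset h3)) h2⟩
      · exact Or.inr ⟨h1, h4⟩

/-- **Every surviving dart of the component of `d` stays connected, inside `S ∖ {d, α d}`, to a
surviving dart at the vertex of `d` or at the vertex of `α d`.** -/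
theorem IsRotSys.exists_near_of_conn {σ α : Perm D} (h : IsRotSys σ α) {S : Finset D}
    (hS : IsClosed α S) {d x : D} (hx : x ∈ S \ {d, α d}) (hc : conn σ α S x d) :
    ∃ w ∈ S \ {d, α d}, conn σ α (S \ {d, α d}) x w ∧ (σ.SameCycle d w ∨ σ.SameCycle (α d) w) := by
  set S' := S \ {d, α d} with hS'
  -- `good z`: `z ∉ S'`, or `z` has such a witness
  let good : D → Prop := fun z =>
    z ∉ S' ∨ ∃ w ∈ S', conn σ α S' z w ∧ (σ.SameCycle d w ∨ σ.SameCycle (α d) w)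
  have mem_e : ∀ b, b ∈ S → b ∉ S' → b = d ∨ b = α d := by
    intro b hb hbe
    rw [hS', Finset.mem_sdiff, not_and, not_not, Finset.mem_insert, Finset.mem_singleton] at hbe
    exact hbe hb
  -- transfer of goodness along an `S'`-connection
  have transfer : ∀ a b, conn σ α S' a b → good a → a ∈ S' → good b := by
    intro a b hab hga ha
    rcases hga with hna | ⟨w, hw, hcw, hnear⟩
    · exact absurd ha hna
    · exact Or.inr ⟨w, hw, conn_trans (conn_symm hab) hcw, hnear⟩
  have key : ∀ a b, conn σ α S a b → (good a ↔ good b) := by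
    intro a b hab
    induction hab with
    | rel a b hab =>
      obtain ⟨ha, hb, hrel⟩ := hab
      by_cases hae : a ∈ S'
      · by_cases hbe : b ∈ S'
        · have hc' : conn σ α S' a b := Relation.EqvGen.rel a b ⟨hae, hbe, hrel⟩
          exact ⟨fun hg => transfer a b hc' hg hae, fun hg => transfer b a (conn_symm hc') hg hbe⟩
        · -- `b ∈ e`: `a` itself is a witness for `a`
          refine ⟨fun _ => Or.inl hbe, fun _ => Or.inr ⟨a, hae, conn_refl σ α S' a, ?_⟩⟩
          rcases hrel with hcyc | hαab
          · rcases mem_e b hb hbe with rfl | rfl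
            · exact Or.inl hcyc.symm
            · exact Or.inr hcyc.symm
          · exfalso
            -- `b = α a ∈ e` forces `a ∈ e`
            have : a ∈ S' → α a ∈ S' := fun h' => isClosed_sdiff_pair h hS d a h'
            exact hbe (hαab ▸ this hae)
      · by_cases hbe : b ∈ S'
        · refine ⟨fun _ => Or.inr ⟨b, hbe, conn_refl σ α S' b, ?_⟩, fun _ => Or.inl hae⟩
          rcases hrel with hcyc | hαab
          · rcases mem_e a ha hae with rfl | rfl
            · exact Or.inl hcyc
            · exact Or.inr hcyc
          · exfalso
            have hαb : α b = a := by rw [hαab, h.α_inv]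
            have : b ∈ S' → α b ∈ S' := fun h' => isClosed_sdiff_pair h hS d b h'
            exact hae (hαb ▸ this hbe)
        · exact ⟨fun _ => Or.inl hbe, fun _ => Or.inl hae⟩
    | refl a => exact Iff.rfl
    | symm a b _ ih => exact ih.symm
    | trans a b c _ _ ih1 ih2 => exact ih1.trans ih2
  have hgd : good d := Or.inl (by
    rw [hS', Finset.mem_sdiff, Finset.mem_insert]; tauto)
  have hgx : good x := (key x d hc).2 hgd
  rcases hgx with hnx | hw
  · exact absurd hx hnx
  · exact hw

section Splice

variable [Fintype D]

/-- In a loopless system the `S`-successor at a vertex is never the opposite dart. -/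
theorem IsRotSys.induce_ne_alpha {σ α : Perm D} (h : IsRotSys σ α) (S : Finset D) (d : D) :
    induce σ S d ≠ α d := by
  intro heq
  have := sameCycle_induce_apply σ S d
  rw [heq] at this
  exact h.loopless d this

/-- If another dart `y ∈ S` lies on the `σ`-cycle of `d`, then `d` is not fixed by the induced
rotation. -/
theorem induce_ne_self_of_mem_cycle (σ : Perm D) {S : Finset D} {d y : D} (hd : d ∈ S)
    (hy : y ∈ S) (hyd : y ≠ d) (hc : σ.SameCycle d y) : induce σ S d ≠ d := by
  intro hfix
  exact hyd ((induce_apply_eq_self_iff σ hd).1 hfix y hy hc)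

/-- **(P) The pointwise splice.** For a loopless rotation system, an `α`-closed `S`, `d ∈ S` and
`x ∈ S \ {d, α d}`: the face permutation of `S \ {d, α d}` at `x` is `φ_S (α d)` if `φ_S x = d`,
`φ_S d` if `φ_S x = α d`, and `φ_S x` otherwise. -/
theorem IsRotSys.phi_sdiff_apply {σ α : Perm D} (h : IsRotSys σ α) {S : Finset D}
    (hS : IsClosed α S) {d : D} (hd : d ∈ S) {x : D} (hx : x ∈ S \ {d, α d}) :
    phi σ α (S \ {d, α d}) x =
      if phi σ α S x = d then phi σ α S (α d)
      else if phi σ α S x = α d then phi σ α S d else phi σ α S x := by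
  set S' := S \ {d, α d} with hS'
  have hsub : S' ⊆ S := Finset.sdiff_subset
  have hS'c : IsClosed α S' := isClosed_sdiff_pair h hS d
  have hy : α x ∈ S' := hS'c x hx
  have hyS : α x ∈ S := hsub hy
  have hxS : x ∈ S := hsub hx
  have hαd : α d ∈ S := hS d hd
  -- membership in `S'` unfolded
  have mem_S' : ∀ z, z ∈ S' ↔ z ∈ S ∧ z ≠ d ∧ z ≠ α d := by
    intro z
    rw [hS', Finset.mem_sdiff, Finset.mem_insert, Finset.mem_singleton, not_or]
  rw [phi_apply, phi_apply, phi_apply, phi_apply, h.α_inv]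
  -- `z := induce σ S (α x) = φ_S x`
  split_ifs with h1 h2
  · -- `φ_S x = d`: skip `d`, land on `induce σ S d`
    have hnot : induce σ S (α x) ∉ S' := by
      rw [h1, mem_S']; tauto
    have hne : induce σ S d ≠ d := by
      refine induce_ne_self_of_mem_cycle σ hd hyS ?_ ?_
      · exact ((mem_S' _).1 hy).2.1
      · have := sameCycle_induce_apply σ S (α x)
        rw [h1] at this
        exact this.symm
    have hmem : induce σ S (induce σ S (α x)) ∈ S' := by
      rw [h1, mem_S']
      exact ⟨induce_apply_mem σ hd, hne, h.induce_ne_alpha S d⟩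
    rw [induce_subset_apply_of_not_mem σ hsub hy hnot hmem, h1]
  · -- `φ_S x = α d`: skip `α d`, land on `induce σ S (α d)`
    have hnot : induce σ S (α x) ∉ S' := by
      rw [h2, mem_S']; tauto
    have hne : induce σ S (α d) ≠ α d := by
      refine induce_ne_self_of_mem_cycle σ hαd hyS ?_ ?_
      · exact ((mem_S' _).1 hy).2.2
      · have := sameCycle_induce_apply σ S (α x)
        rw [h2] at this
        exact this.symm
    have hne' : induce σ S (α d) ≠ d := by
      have := h.induce_ne_alpha S (α d)
      rwa [h.α_inv] at this
    have hmem : induce σ S (induce σ S (α x)) ∈ S' := by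
      rw [h2, mem_S']
      exact ⟨induce_apply_mem σ hαd, hne', hne⟩
    rw [induce_subset_apply_of_not_mem σ hsub hy hnot hmem, h2]
  · -- generic case: the `S`-successor is already in `S'`
    have hmem : induce σ S (α x) ∈ S' := by
      rw [mem_S']
      exact ⟨induce_apply_mem σ hyS, h1, h2⟩
    exact induce_subset_apply_of_mem σ hsub hy hmem

/-- The two darts of the deleted edge never reappear: `φ_{S∖e}` maps `S ∖ e` to itself. -/
theorem IsRotSys.phi_sdiff_apply_mem {σ α : Perm D} (h : IsRotSys σ α) {S : Finset D}
    (hS : IsClosed α S) (d : D) {x : D} (hx : x ∈ S \ {d, α d}) :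
    phi σ α (S \ {d, α d}) x ∈ S \ {d, α d} :=
  phi_apply_mem (isClosed_sdiff_pair h hS d) hx

end Splice

end RotSys

end Summit.Ventures.Crystal3D
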